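import Summits.Ventures.GridStability.Models.KronReduction
import Summits.Ventures.GridStability.Models.StructurePreservingDAE

/-!
# GridStability/Models/KronReductionDAE — «constant-impedance loads + Kron reduction ⇒ the classical internal-node model», in the kernel

Cell `gridfusion` (LADDER-GRIDFUSION G3 model register), seat gridfusion-model-1, `plan/PARTITION.md`
§0 row `Models/`. THREE COLUMNS: MODELLED column only (models MV-4 → MV-2 of `plan/MODEL-VALIDITY.md`);
an exact statement about two typed models; no certificate, no sentence about any grid.

## Statement, AS PRINTED

[cite: SauerPai1998, §7.9.2 (7.191)–(7.198) and §7.9.3 (7.205)–(7.212)]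
[galaxy:panama:353827995779076 chunks p0130–p0131]: starting from the structure-preserving
classical model (model-2's `StructurePreservingDAE.Params.IsSolution`, eqs (7.193)–(7.196): swing
equations driven by `P_Gi = EᵢVᵢ sin(δᵢ − θᵢ)/X′_di` plus active/reactive power balance at every bus
of the lossless network `Ȳ_N = [jB_kl]`), «the loads are assumed to be constant impedances and
converted to admittances `ȳ_Lk`» (7.205), the machine reactances and load admittances are put into
the augmented matrix (7.206)–(7.207), «the n network buses can be eliminated, since there is no
current injection at these buses» (7.208), and the swing equations become those of the internal-node
model with `P_ei = Σ_j E_iE_j(G_ij cos δ_ij + B_ij sin δ_ij)` (7.209)–(7.212) — model-1's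
`ClassicalSwing` (p459650).

## What is proved

For a DAE parameter record `p` with CONSTANT-ADMITTANCE loads `P_Lk(V) = −g_k V²`,
`Q_Lk(V) = b_k V²` (injected convention of S&P §6.3; `ȳ_Lk = g_k + j b_k`):

* `augmentedY p g b` — the augmented admittance matrix of (7.206)–(7.207) on
  (internal nodes `Fin m`) ⊕ (buses `Fin n`): `Ȳ_A = diag(1/(jX′_d))`, `Ȳ_B`/`Ȳ_C` the machine
  branches `−1/(jX′_d)` to the terminal buses, `Ȳ_D = [jB_kl] + diag(ȳ_Lk + Σ_{i at k} 1/(jX′_di))`;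
* `busCurrent_eq_zero` — along every DAE solution with nonzero bus voltages, the phasor state
  `(E∠δ, V∠θ)` has ZERO current injection at every bus (the power balances (7.195)–(7.196), divided by
  `V̄_k ≠ 0`, ARE Kirchhoff's current law of the augmented network);
* `re_power_eq_PG` — the real power into machine branch `i`, `Re[Ēᵢ Īᵢ*]` with
  `Īᵢ = (Ēᵢ − V̄_{bus i})/(jX′_di)` = upper block row of (7.207), equals `P_Gi` (7.191) (lossless stator);
* `PG_eq_Pe_reduce` — hence, whenever `Ȳ_D` is invertible, `P_Gi(δ, V, θ) = ClassicalSwing.Pe` of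
  the Kron-reduced record `Kron.classicalOfNetwork M 0 T_M E (augmentedY p g b)` at the angles `δ`
  (uses model-1's `Kron.pe_eq_re_power_of_network_solution`, p478163);
* `classical_isSolutionOn_of_isSolution` — **every solution `(δ, ω, V, θ)` of the structure-preserving
  DAE with constant-admittance loads and `V_k(t) ≠ 0` yields a solution `t ↦ (δ(t), ω(t) − ω_s)` of
  model-1's `ClassicalSwing.field` for the Kron-reduced record** (`M_i = 2H_i/ω_s`, `D = 0` as printed
  in (7.194), `P = T_M`);
* the CONVERSE lift (classical solution + Kron-recovered bus voltages ⇒ DAE solution) and the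
  reciprocity of the reduced couplings are in `Models/KronReductionDAELift.lean`. This is the kernel form of the sentence in model-2's
  `StructurePreservingDAE` docstring «constant-impedance loads + Kron reduction ⇒ model-1's
  `ClassicalSwing` (MV-2)» and of MODEL-VALIDITY rows MV-2/MV-4.

Hypotheses kept explicit (MODELLED, MV-4(c)): `V_k(t) ≠ 0` along the solution and `det Ȳ_D ≠ 0`
(for constant-impedance loads the algebraic equations are then uniquely solvable:
`Kron.network_equations_iff`). MODELLED: absent effects = MV-1 list + constant-impedance loads (MV-5*).
-/

noncomputable section

open Matrix Complex Finset

namespace Summit.Ventures.GridStability.Models.StructurePreservingDAE.Params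

variable {m n : ℕ} (p : Params m n)

/-! ## The augmented admittance matrix (7.206)–(7.207) -/

/-- Machine branch admittance `1/(jX′_di) = −j/X′_di`. -/
def yMachine (i : Fin m) : ℂ := -I / (p.Xd' i : ℂ)

/-- Constant load admittance `ȳ_Lk = g_k + j b_k` at bus `k` [cite: SauerPai1998, (7.205)]
(injected-convention loads `P_Lk(V) = −g_k V²`, `Q_Lk(V) = b_k V²`). -/
def yLoad (g b : Fin n → ℝ) (k : Fin n) : ℂ := (g k : ℂ) + (b k : ℂ) * I

/-- **Augmented admittance matrix** of the structure-preserving network with machine reactances and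
constant-admittance loads [cite: SauerPai1998, (7.206)–(7.207)], block-indexed by
(internal machine nodes `Fin m`) ⊕ (network buses `Fin n`):
`Ȳ_A = diag(1/(jX′_d))`, `(Ȳ_B)_{i,k} = (Ȳ_C)_{k,i} = −1/(jX′_di)` if machine `i` sits at bus `k`,
`Ȳ_D = [jB_kl] + diag(ȳ_Lk + Σ_{i at k} 1/(jX′_di))`. -/
def augmentedY (g b : Fin n → ℝ) : Matrix (Fin m ⊕ Fin n) (Fin m ⊕ Fin n) ℂ :=
  Matrix.fromBlocks
    (Matrix.diagonal fun i => p.yMachine i)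
    (Matrix.of fun i k => if p.bus i = k then -p.yMachine i else 0)
    (Matrix.of fun k i => if p.bus i = k then -p.yMachine i else 0)
    (Matrix.of fun k l => (p.B k l : ℂ) * I +
      (if k = l then yLoad g b k + ∑ i ∈ univ.filter (fun i => p.bus i = k), p.yMachine i else 0))

/-- Bus voltage phasors `V̄_k = V_k e^{jθ_k}`. -/
def busPhasor {n : ℕ} (V θ : Fin n → ℝ) (k : Fin n) : ℂ := (V k : ℂ) * exp ((θ k : ℂ) * I)

/-- The phasor state of the augmented network: internal EMFs `E∠δ` (model-1's `Kron.phasor`) on the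
machine nodes, `V∠θ` on the buses. -/
def networkState (δ : Fin m → ℝ) (V θ : Fin n → ℝ) : Fin m ⊕ Fin n → ℂ :=
  Sum.elim (Kron.phasor p.E δ) (busPhasor V θ)

/-! ## Phasor algebra -/

/-- `e^{jα} (e^{jβ})^* = e^{j(α−β)}`. -/
theorem exp_mul_conj_exp (α β : ℝ) :
    exp ((α : ℂ) * I) * (starRingEnd ℂ) (exp ((β : ℂ) * I)) = exp (((α - β : ℝ) : ℂ) * I) := by
  rw [← Complex.exp_conj, map_mul, Complex.conj_ofReal, Complex.conj_I, ← Complex.exp_add]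
  congr 1
  push_cast
  ring

/-- Real and imaginary parts of `e^{jx}` for real `x`. -/
theorem exp_mul_I_eq (x : ℝ) : exp ((x : ℂ) * I) = ⟨Real.cos x, Real.sin x⟩ := by
  apply Complex.ext <;> simp [exp_ofReal_mul_I_re, exp_ofReal_mul_I_im]

/-- `e^{jx} (e^{jx})^* = 1`. -/
theorem exp_mul_conj_exp_self (x : ℝ) :
    exp ((x : ℂ) * I) * (starRingEnd ℂ) (exp ((x : ℂ) * I)) = 1 := by
  rw [exp_mul_conj_exp, sub_self]
  simp

/-- `V̄_k (jB V̄_l)^* = V_kV_lB (sin(θ_k − θ_l) − j cos(θ_k − θ_l))`: one term of (7.197)–(7.198). -/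
theorem busPhasor_mul_conj_line {n : ℕ} (V θ : Fin n → ℝ) (B : ℝ) (k l : Fin n) :
    busPhasor V θ k * (starRingEnd ℂ) (((B : ℂ) * I) * busPhasor V θ l) =
      ⟨V k * V l * B * Real.sin (θ k - θ l), -(V k * V l * B * Real.cos (θ k - θ l))⟩ := by
  have h : busPhasor V θ k * (starRingEnd ℂ) (((B : ℂ) * I) * busPhasor V θ l) =
      ((V k : ℂ) * (V l : ℂ) * (B : ℂ)) * (-I) *
        (exp ((θ k : ℂ) * I) * (starRingEnd ℂ) (exp ((θ l : ℂ) * I))) := by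
    simp only [busPhasor, map_mul, Complex.conj_ofReal, Complex.conj_I]
    ring
  rw [h, exp_mul_conj_exp, exp_mul_I_eq]
  apply Complex.ext <;> simp [Complex.mul_re, Complex.mul_im]

/-- `V̄_k (ȳ V̄_k)^* = V_k² ȳ^*`: the shunt-load term. -/
theorem busPhasor_mul_conj_shunt {n : ℕ} (V θ : Fin n → ℝ) (y : ℂ) (k : Fin n) :
    busPhasor V θ k * (starRingEnd ℂ) (y * busPhasor V θ k) =
      ((V k : ℂ) ^ 2) * (starRingEnd ℂ) y := by
  have h : busPhasor V θ k * (starRingEnd ℂ) (y * busPhasor V θ k) =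
      ((V k : ℂ) ^ 2) * (starRingEnd ℂ) y *
        (exp ((θ k : ℂ) * I) * (starRingEnd ℂ) (exp ((θ k : ℂ) * I))) := by
    simp only [busPhasor, map_mul, Complex.conj_ofReal]
    ring
  rw [h, exp_mul_conj_exp_self, mul_one]

/-- `V̄_k ((V̄_k − Ē_i)(−j/X′))^* = −P_Gi − jQ_Gi`: the machine-branch term seen from the bus
[(7.191)–(7.192)]. -/
theorem busPhasor_mul_conj_machine (δ : Fin m → ℝ) (V θ : Fin n → ℝ) (i : Fin m) {k : Fin n}
    (hk : p.bus i = k) :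
    busPhasor V θ k * (starRingEnd ℂ) (p.yMachine i * (busPhasor V θ k - Kron.phasor p.E δ i)) =
      ⟨-p.PG δ V θ i, -p.QG δ V θ i⟩ := by
  subst hk
  have h : busPhasor V θ (p.bus i) * (starRingEnd ℂ)
        (p.yMachine i * (busPhasor V θ (p.bus i) - Kron.phasor p.E δ i)) =
      (I / (p.Xd' i : ℂ)) * (((V (p.bus i) : ℂ)) ^ 2 *
          (exp ((θ (p.bus i) : ℂ) * I) * (starRingEnd ℂ) (exp ((θ (p.bus i) : ℂ) * I)))
        - (V (p.bus i) : ℂ) * (p.E i : ℂ) *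
          (exp ((θ (p.bus i) : ℂ) * I) * (starRingEnd ℂ) (exp ((δ i : ℂ) * I)))) := by
    simp only [busPhasor, Kron.phasor, yMachine, map_mul, map_sub, map_neg, map_div₀,
      Complex.conj_ofReal, Complex.conj_I]
    ring
  rw [h, exp_mul_conj_exp_self, mul_one, exp_mul_conj_exp, exp_mul_I_eq]
  have hX : (p.Xd' i : ℂ) = ⟨p.Xd' i, 0⟩ := rfl
  have hre : ((V (p.bus i) : ℂ) ^ 2).re = V (p.bus i) ^ 2 := by
    rw [← Complex.ofReal_pow]; exact Complex.ofReal_re _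
  have him : ((V (p.bus i) : ℂ) ^ 2).im = 0 := by
    rw [← Complex.ofReal_pow]; exact Complex.ofReal_im _
  apply Complex.ext
  · simp [PG, Complex.div_re, Complex.div_im, hX, Complex.normSq, hre, him]
    have hc : Real.cos (θ (p.bus i) - δ i) = Real.cos (δ i - θ (p.bus i)) := by
      rw [← Real.cos_neg, neg_sub]
    have hs : Real.sin (θ (p.bus i) - δ i) = -Real.sin (δ i - θ (p.bus i)) := by
      rw [← Real.sin_neg, neg_sub]
    rw [hs]
    by_cases hX0 : p.Xd' i = 0
    · simp [hX0]
    · field_simp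
  · simp [QG, Complex.div_re, Complex.div_im, hX, Complex.normSq, hre, him]
    by_cases hX0 : p.Xd' i = 0
    · simp [hX0]
    · field_simp
      ring

/-! ## The two block rows of (7.207) along a DAE state -/

/-- Upper block row: the current leaving internal node `i` is the machine-branch current
`Īᵢ = (Ēᵢ − V̄_{bus i})/(jX′_di)`. -/
theorem machineCurrent_eq (g b : Fin n → ℝ) (δ : Fin m → ℝ) (V θ : Fin n → ℝ) (i : Fin m) :
    (p.augmentedY g b *ᵥ p.networkState δ V θ) (Sum.inl i) =
      p.yMachine i * (Kron.phasor p.E δ i - busPhasor V θ (p.bus i)) := by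
  rw [networkState, Kron.mulVec_inl]
  simp only [augmentedY, Matrix.toBlocks_fromBlocks₁₁, Matrix.toBlocks_fromBlocks₁₂, Pi.add_apply,
    mulVec_diagonal]
  simp only [mulVec, dotProduct, Matrix.of_apply, ite_mul, zero_mul, Finset.sum_ite_eq,
    Finset.mem_univ, if_true]
  ring

/-- Lower block row: the net current injected at bus `k` by the augmented network is
`Σ_l jB_kl V̄_l + ȳ_Lk V̄_k + Σ_{i at k} (V̄_k − Ēᵢ)/(jX′_di)`. -/
theorem busCurrent_eq (g b : Fin n → ℝ) (δ : Fin m → ℝ) (V θ : Fin n → ℝ) (k : Fin n) :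
    (p.augmentedY g b *ᵥ p.networkState δ V θ) (Sum.inr k) =
      ∑ l, ((p.B k l : ℂ) * I) * busPhasor V θ l + yLoad g b k * busPhasor V θ k +
        ∑ i ∈ univ.filter (fun i => p.bus i = k),
          p.yMachine i * (busPhasor V θ k - Kron.phasor p.E δ i) := by
  rw [networkState, Kron.mulVec_inr]
  simp only [augmentedY, Matrix.toBlocks_fromBlocks₂₁, Matrix.toBlocks_fromBlocks₂₂, Pi.add_apply,
    mulVec, dotProduct, Matrix.of_apply]
  have e1 : ∑ i, (if p.bus i = k then -p.yMachine i else 0) * Kron.phasor p.E δ i =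
      -∑ i ∈ univ.filter (fun i => p.bus i = k), p.yMachine i * Kron.phasor p.E δ i := by
    rw [Finset.sum_filter, ← Finset.sum_neg_distrib]
    refine Finset.sum_congr rfl fun i _ => ?_
    split_ifs <;> simp
  have e2 : ∑ l, ((p.B k l : ℂ) * I +
        (if k = l then yLoad g b k + ∑ i ∈ univ.filter (fun i => p.bus i = k), p.yMachine i
          else 0)) * busPhasor V θ l =
      ∑ l, ((p.B k l : ℂ) * I) * busPhasor V θ l +
        (yLoad g b k + ∑ i ∈ univ.filter (fun i => p.bus i = k), p.yMachine i) *
          busPhasor V θ k := by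
    simp only [add_mul, Finset.sum_add_distrib, ite_mul, zero_mul, Finset.sum_ite_eq,
      Finset.mem_univ, if_true]
  have e3 : ∑ i ∈ univ.filter (fun i => p.bus i = k),
        p.yMachine i * (busPhasor V θ k - Kron.phasor p.E δ i) =
      (∑ i ∈ univ.filter (fun i => p.bus i = k), p.yMachine i) * busPhasor V θ k -
        ∑ i ∈ univ.filter (fun i => p.bus i = k), p.yMachine i * Kron.phasor p.E δ i := by
    rw [Finset.sum_mul, ← Finset.sum_sub_distrib]
    refine Finset.sum_congr rfl fun i _ => ?_
    ring
  rw [e1, e2, e3]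
  ring

/-- **Complex power balance at a bus = V̄_k × (KCL)^*.** For constant-admittance loads
(`P_Lk(V) = −g_k V²`, `Q_Lk(V) = b_k V²`), `V̄_k (Ī_k)^*` — with `Ī_k` the net injected current of
`busCurrent_eq` — has real part `P_net,k − P_Lk − P_Gbus,k` and imaginary part
`Q_net,k − Q_Lk − Q_Gbus,k` [cite: SauerPai1998, (7.195)–(7.198)]. -/
theorem busPhasor_mul_conj_busCurrent {g b : Fin n → ℝ}
    (hPL : ∀ k v, p.PL k v = -(g k) * v ^ 2) (hQL : ∀ k v, p.QL k v = b k * v ^ 2)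
    (δ : Fin m → ℝ) (V θ : Fin n → ℝ) (k : Fin n) :
    busPhasor V θ k * (starRingEnd ℂ) ((p.augmentedY g b *ᵥ p.networkState δ V θ) (Sum.inr k)) =
      ⟨p.Pnet V θ k - p.PL k (V k) - p.PGbus δ V θ k,
        p.Qnet V θ k - p.QL k (V k) - p.QGbus δ V θ k⟩ := by
  rw [busCurrent_eq, map_add, map_add, map_sum, map_sum, mul_add, mul_add, Finset.mul_sum,
    Finset.mul_sum]
  simp only [busPhasor_mul_conj_line, busPhasor_mul_conj_shunt]
  have hmach : ∑ i ∈ univ.filter (fun i => p.bus i = k),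
      busPhasor V θ k * (starRingEnd ℂ) (p.yMachine i * (busPhasor V θ k - Kron.phasor p.E δ i)) =
      ∑ i ∈ univ.filter (fun i => p.bus i = k), (⟨-p.PG δ V θ i, -p.QG δ V θ i⟩ : ℂ) := by
    refine Finset.sum_congr rfl fun i hi => ?_
    exact p.busPhasor_mul_conj_machine δ V θ i (Finset.mem_filter.1 hi).2
  rw [hmach, hPL, hQL]
  have hV2 : ((V k : ℂ) ^ 2) * (starRingEnd ℂ) (yLoad g b k) = ⟨g k * V k ^ 2, -(b k * V k ^ 2)⟩ := by
    apply Complex.ext <;>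
      simp [yLoad, Complex.mul_re, Complex.mul_im, ← Complex.ofReal_pow] <;> ring
  rw [hV2]
  apply Complex.ext
  · simp only [Complex.add_re, Complex.re_sum, Pnet, PGbus, Finset.sum_neg_distrib]
    ring
  · simp only [Complex.add_im, Complex.im_sum, Qnet, QGbus, Finset.sum_neg_distrib]
    ring

/-- **KCL at the buses along DAE solutions.** For constant-admittance loads, along every solution
of the structure-preserving DAE whose bus voltages do not vanish, the phasor state `(E∠δ, V∠θ)` has
ZERO net current injection at every network bus — the lower block of (7.207) «there is no current
injection at these buses». -/
theorem busCurrent_eq_zero {g b : Fin n → ℝ}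
    (hPL : ∀ k v, p.PL k v = -(g k) * v ^ 2) (hQL : ∀ k v, p.QL k v = b k * v ^ 2)
    {δ ω : ℝ → Fin m → ℝ} {V θ : ℝ → Fin n → ℝ} (h : p.IsSolution δ ω V θ)
    {t : ℝ} (hV : ∀ k, V t k ≠ 0) (k : Fin n) :
    (p.augmentedY g b *ᵥ p.networkState (δ t) (V t) (θ t)) (Sum.inr k) = 0 := by
  have hprod := p.busPhasor_mul_conj_busCurrent hPL hQL (δ t) (V t) (θ t) k
  have hP := h.activeBalance t k
  have hQ := h.reactiveBalance t k
  have hzero : busPhasor (V t) (θ t) k *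
      (starRingEnd ℂ) ((p.augmentedY g b *ᵥ p.networkState (δ t) (V t) (θ t)) (Sum.inr k)) = 0 := by
    rw [hprod]
    apply Complex.ext <;> simp <;> linarith
  have hVk : busPhasor (V t) (θ t) k ≠ 0 := by
    simp only [busPhasor, ne_eq, mul_eq_zero, Complex.ofReal_eq_zero, Complex.exp_ne_zero, or_false]
    exact hV k
  have := (mul_eq_zero.1 hzero).resolve_left hVk
  simpa using this

/-- **The stator branch is lossless: `Re[Ēᵢ Īᵢ^*] = P_Gi`** — the real power leaving internal node
`i` through `jX′_di` equals the power delivered at the terminal bus (7.191) (= `EᵢI_qi`, (7.188)). -/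
theorem re_power_eq_PG (g b : Fin n → ℝ) (δ : Fin m → ℝ) (V θ : Fin n → ℝ) (i : Fin m) :
    (Kron.phasor p.E δ i * (starRingEnd ℂ)
      ((p.augmentedY g b *ᵥ p.networkState δ V θ) (Sum.inl i))).re = p.PG δ V θ i := by
  rw [machineCurrent_eq]
  have h : Kron.phasor p.E δ i * (starRingEnd ℂ)
        (p.yMachine i * (Kron.phasor p.E δ i - busPhasor V θ (p.bus i))) =
      (I / (p.Xd' i : ℂ)) * (((p.E i : ℂ)) ^ 2 *
          (exp ((δ i : ℂ) * I) * (starRingEnd ℂ) (exp ((δ i : ℂ) * I)))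
        - (p.E i : ℂ) * (V (p.bus i) : ℂ) *
          (exp ((δ i : ℂ) * I) * (starRingEnd ℂ) (exp ((θ (p.bus i) : ℂ) * I)))) := by
    simp only [busPhasor, Kron.phasor, yMachine, map_mul, map_sub, map_neg, map_div₀,
      Complex.conj_ofReal, Complex.conj_I]
    ring
  rw [h, exp_mul_conj_exp_self, mul_one, exp_mul_conj_exp, exp_mul_I_eq]
  have hX : (p.Xd' i : ℂ) = ⟨p.Xd' i, 0⟩ := rfl
  have hre : ((p.E i : ℂ) ^ 2).re = p.E i ^ 2 := by
    rw [← Complex.ofReal_pow]; exact Complex.ofReal_re _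
  have him : ((p.E i : ℂ) ^ 2).im = 0 := by
    rw [← Complex.ofReal_pow]; exact Complex.ofReal_im _
  simp [PG, Complex.div_re, Complex.div_im, hX, Complex.normSq, hre, him]
  by_cases hX0 : p.Xd' i = 0
  · simp [hX0]
  · field_simp

/-! ## The reduction theorem -/

/-- The Kron-reduced internal-node classical record of the DAE data with constant-admittance loads:
machine data `Mᵢ = 2Hᵢ/ω_s`, `D = 0` (no damping term is printed in (7.194)), `Pᵢ = T_Mi`, `Eᵢ`, and
`G + jB = Kron.reduce (augmentedY p g b)` [cite: SauerPai1998, §7.9.3 (7.208)–(7.209)]. MODELLED: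
MV-2 (+ constant-impedance loads MV-5*). -/
def kronClassical (g b : Fin n → ℝ) : ClassicalSwing m :=
  Kron.classicalOfNetwork p.M (fun _ => 0) p.TM p.E (p.augmentedY g b)

/-- **`P_Gi = P_ei` of the reduced model, state by state.** For any phasor state `(E∠δ, V∠θ)` with
zero net current injection at every bus (KCL of the augmented network) and `Ȳ_D` invertible, the
generator power (7.191) equals model-1's `ClassicalSwing.Pe` of the Kron-reduced record at the angles `δ`
[cite: SauerPai1998, (7.208)–(7.212)] (model-1 `Kron.pe_eq_re_power_of_network_solution`, p478163). -/
theorem PG_eq_Pe_of_kcl (g b : Fin n → ℝ) (hD : IsUnit (p.augmentedY g b).toBlocks₂₂.det)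
    (δ : Fin m → ℝ) (V θ : Fin n → ℝ)
    (h0 : ∀ k, (p.augmentedY g b *ᵥ p.networkState δ V θ) (Sum.inr k) = 0) (i : Fin m) :
    p.PG δ V θ i = (p.kronClassical g b).Pe δ i := by
  rw [← p.re_power_eq_PG g b δ V θ i, kronClassical,
    Kron.pe_eq_re_power_of_network_solution p.M (fun _ => 0) p.TM p.E (p.augmentedY g b) hD δ
      (V := busPhasor V θ) h0 i]
  rfl

/-- **`P_Gi = P_ei` along DAE solutions.** Constant-admittance loads, nonvanishing bus voltages and
`Ȳ_D` invertible: the generator power of the structure-preserving model equals `ClassicalSwing.Pe` of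
the Kron-reduced record at the same rotor angles. -/
theorem PG_eq_Pe_reduce {g b : Fin n → ℝ}
    (hPL : ∀ k v, p.PL k v = -(g k) * v ^ 2) (hQL : ∀ k v, p.QL k v = b k * v ^ 2)
    (hD : IsUnit (p.augmentedY g b).toBlocks₂₂.det)
    {δ ω : ℝ → Fin m → ℝ} {V θ : ℝ → Fin n → ℝ} (h : p.IsSolution δ ω V θ)
    {t : ℝ} (hV : ∀ k, V t k ≠ 0) (i : Fin m) :
    p.PG (δ t) (V t) (θ t) i = (p.kronClassical g b).Pe (δ t) i :=
  p.PG_eq_Pe_of_kcl g b hD (δ t) (V t) (θ t) (fun k => p.busCurrent_eq_zero hPL hQL h hV k) i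

/-- **Structure-preserving DAE with constant-impedance loads ⇒ classical internal-node ODE (7.209)–(7.216).**
MODELLED: MV-4 → MV-2. For every solution `(δ, ω, V, θ)` of model-2's structure-preserving classical
DAE whose loads are constant admittances and whose bus voltages never vanish, with `Ȳ_D` invertible,
the machine trajectory `t ↦ (δ(t), ω(t) − ω_s)` is a solution (on all of `ℝ`) of model-1's classical
network-reduced model `ClassicalSwing.field` for the Kron-reduced record `kronClassical p g b`
(deviation speeds, `D = 0`). The elimination is exact; «constant-impedance loads» is the only modelling
step. [cite: SauerPai1998, §7.9.2–§7.9.3] -/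
theorem classical_isSolutionOn_of_isSolution {g b : Fin n → ℝ}
    (hPL : ∀ k v, p.PL k v = -(g k) * v ^ 2) (hQL : ∀ k v, p.QL k v = b k * v ^ 2)
    (hD : IsUnit (p.augmentedY g b).toBlocks₂₂.det) (hM : ∀ i, p.M i ≠ 0)
    {δ ω : ℝ → Fin m → ℝ} {V θ : ℝ → Fin n → ℝ} (h : p.IsSolution δ ω V θ)
    (hV : ∀ t k, V t k ≠ 0) :
    (p.kronClassical g b).IsSolutionOn (fun t => (δ t, fun i => ω t i - p.ωs)) Set.univ := by
  intro t _
  apply HasDerivAt.hasDerivWithinAt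
  have h1 : HasDerivAt (fun s => δ s) (fun i => ω t i - p.ωs) t := by
    -- angles: dδᵢ/dt = ωᵢ − ω_s
    rw [hasDerivAt_pi]
    intro i
    have hd := (h.differentiable_δ i t).hasDerivAt
    rw [h.angle t i] at hd
    exact hd
  have h2 : HasDerivAt (fun s => fun i => ω s i - p.ωs)
      (fun i => (p.TM i - (p.kronClassical g b).Pe (δ t) i) / p.M i) t := by
    -- speeds: d(ωᵢ − ω_s)/dt = (T_Mi − P_ei(δ))/Mᵢ
    rw [hasDerivAt_pi]
    intro i
    have hd := ((h.differentiable_ω i t).hasDerivAt).sub_const p.ωs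
    have hsw := h.swing t i
    rw [p.PG_eq_Pe_reduce hPL hQL hD h (hV t) i] at hsw
    have hderiv : deriv (fun s => ω s i) t =
        (p.TM i - (p.kronClassical g b).Pe (δ t) i) / p.M i := by
      rw [eq_div_iff (hM i), mul_comm]; exact hsw
    rw [hderiv] at hd
    exact hd
  have h12 := h1.prodMk h2
  refine h12.congr_deriv ?_
  have hMeq : ∀ i, (p.kronClassical g b).M i = p.M i := fun _ => rfl
  have hPeq : ∀ i, (p.kronClassical g b).P i = p.TM i := fun _ => rfl
  have hDeq : ∀ i, (p.kronClassical g b).D i = 0 := fun _ => rfl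
  simp only [ClassicalSwing.field, hMeq, hPeq, hDeq, zero_mul, sub_zero]

end Summit.Ventures.GridStability.Models.StructurePreservingDAE.Params

end
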